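import Summits.QuantumFields.BalabanUV.Beta.EriceRemainderEnclosureHistoryRenewalWitnessEnvelope
import Summits.QuantumFields.BalabanUV.Beta.EriceRemainderEnclosureHistoryFadingWitness

/-!
# EriceRemainderEnclosureHistoryFadingWitnessEnvelope — (E36e) HOW FAST THE RATIO MUST DEGRADE WITH THE FADING CONSTANT: the
# two-parameter witness of (E35d) (depth `E`, `s + 1` stages) has fading constant `≤ C_{E,s} ≍ θ^{−(2Es+1)}`, row cost `≍ (E+1)³(s+1)⁷θ^{2E}`
# and beats at `j = 2E + s(2E+1) + E·s(s+1)` with `disc ≥ cθ^{2E(s+1)}∕(s+1)`; hence any `(D, κ)` serving the class with that constant has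
# `D·κ^{2E + s(2E+1) + Es(s+1)} ≥ cθ^{2E(s+1)}∕(s+1)` — with `E ≍ log s` (what the row budget allows) `log(1∕κ(C)) ≲ log log C∕log C`, matching
# (E36b)'s guaranteed `1∕log C` up to the double logarithm

Cell `pub-balaban`, β-function sub-cell, BINDER row D4 «RemainderConst leaves for Bałaban's split» (`HOME/BINDER-OWNERS.md`; owner
lineage `b2b-balaban-beta-an4`; this file by co-owner #2 lineage `b2b-balaban-beta-d4-p2`, generation 38), β-FLOW TEAM duty (1),
FREEZE (0) honoured (def-free; no new leaf, no new hypothesis shape).  Quantitative companion of (E36c) `EriceRemainderEnclosureHistoryFadingWitness`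
(`witness_core_fading` with its explicit fading constant, `staged_witness_fading` ∕ `ratio_lower_bound` for the
one-parameter staged pattern: `log(1∕κ(C)) ≲ 1∕√log C`) over (E35d) `EriceRemainderEnclosureHistoryRenewalWitnessEnvelope` (`twoParam_cost_le`
BY NAME).

HONEST FRAMING (page 1, verbatim and binding).  *"Discharging BetaPertH makes Bałaban's UV stability UNCONDITIONAL — a real
constructive-QFT result; it is NOT the continuum limit and NOT the Clay problem."*  THIS FILE DISCHARGES NOTHING OF THE KIND.  It is
[folklore] real analysis — an explicit WITNESS family about the cell's own NOT-IN-PRINT binders (node U2's `ScaleShiftRate`,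
`HistLipschitz`, `FadingMemory`, GAPS G-t4-U2-1∕-2; the floor shape of (0.31)); nothing of [I] (1.22) is asserted; nothing of Bałaban's is
quoted newly.  Row D4 class UNCHANGED (critical-path width 0; instance 0∕1; D4 DISCHARGE NO DATE).  HONEST DEPENDENCY: continuum YM on T⁴ ⇐
BetaPertH ∧ nine spine estimates (0/9 proved); BetaPertH ⇐ (D1) ∧ (D4) ∧ CAP+tail; G-an2-4 gates asym, D1 and NE2/3/4.

THE POINT (census sense (α)).  (E36b) guarantees, for the class with fading constant `C` and row budget `M` (`4MU < 1`), ONE ratio with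
`log(1∕κ(C)) ≳ log(1∕θ)·log(1∕(4MU))∕log(C∕M)`; (E36c)'s staged witnesses force `log(1∕κ(C)) ≲ (log 1∕θ)^{3∕2}∕√(log C)`.  The gap is an
artefact of the one-parameter pattern (ages spaced by `2s`, far more than the row budget needs).  The two-parameter pattern of (E35d) —
ages `a_t = 2E(t+1) + 1` spaced by `2E`, `s + 1` stages — has row cost `≤ (1 + 1∕γ² + 5(b+c))³(c∕b+1)(E+1)³(s+1)⁷θ^{2E}` (so a FIXED row budget
admits every `s` once `E ≍ log s∕log(1∕θ)`), fading constant `≤ C_{E,s} = (1 + 1∕γ² + (b+c)(K+1))³(c∕b+s)∕θ^{2Es+1}` (`K = 2E + s(2E+1) + Es(s+1) + 1`;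
`log C_{E,s} = (2Es+1)·log(1∕θ) + O(log s + log E)`), and beats every `D·κ^j` with `D·κ^{K−1} < cθ^{2E(s+1)}∕(s+1)` at `j = K − 1 ≍ Es²`.  So any
ratio serving the class with constant `C_{E,s}` has `log(1∕κ) ≤ (2E(s+1)·log(1∕θ) + log((s+1)D∕c))∕(K−1) ≍ 2log(1∕θ)∕s`, and along `E ≍ log s`:
`s ≍ log C∕(2E·log(1∕θ)) ≍ log C∕log log C`, i.e. `log(1∕κ(C)) ≲ log(1∕θ)·log log C∕log C` — (E36b)'s `1∕log C` is sharp up to the double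
logarithm (asymptotics by inspection; the kernel states the explicit finite-`(E, s)` inequality).  NOT B12 Thm 2, NOT BetaPertH, NOT
continuum, NOT Clay.

WHAT IS PROVED ([folklore]; 0 `def`, 0 sorry; nothing of [I] asserted).
 **`twoParam_witness_fading`** (the two-parameter witness with its fading constant `≤ C_{E,s}` and its row cost, explicitly),
 **`ratio_lower_bound_twoParam`** (any `(D, κ)` serving the class with fading constant `C_{E,s}` and the two-parameter row budget has
 `cθ^{2E(s+1)}∕(s+1) ≤ D·κ^{2E + s(2E+1) + Es(s+1)}`).
-/

noncomputable section
open Finset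

namespace Summit.QuantumFields.BalabanUV.Beta.EriceRemainderEnclosureHistoryFadingWitnessEnvelope

open Literature.MathematicalPhysics.QuantumFieldTheory.Balaban1983to89
open Literature.MathematicalPhysics.QuantumFieldTheory.Balaban1983to89.FlowStep
open Literature.MathematicalPhysics.QuantumFieldTheory.Balaban1983to89.T4CouplingMatching
open Summit.QuantumFields.BalabanUV.Beta.EriceRemainderEnclosureHistoryRenewalWitnessEnvelope (twoParam_cost_le)
open Summit.QuantumFields.BalabanUV.Beta.EriceRemainderEnclosureHistoryFadingWitness (witness_core_fading)

/-- **THE TWO-PARAMETER WITNESS WITH ITS FADING CONSTANT, EXPLICITLY.**  For all `c θ γ b > 0` (`θ ≤ 1`), every depth `E` and stage count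
`s` with `cθ^{2E} ≤ b`, (E35d)'s pattern (`a_t = 2E(t+1) + 1`, `k_t = 2E + t(2E+1) + E·t(t+1)`, cutoff `K = k_s + 1`) gives a member of the class
— two pinned runs of (0.20) in ]0,γ], `ScaleShiftRate c θ γ β`, `HistLipschitz Λ γ β`, `Λ ≥ 0`, rows `≤ (1 + 1∕γ² + 5(b+c))³(c∕b+1)(E+1)³(s+1)⁷θ^{2E}`
((E35d) `twoParam_cost_le`), sign, floor — whose modulus is fading with constant AT MOST
`C_{E,s} = (1 + 1∕γ² + (b+c)·(2E + s(2E+1) + Es(s+1) + 2))³·(c∕b + s)∕θ^{2Es+1}` and whose discrepancy at `j = k_s` is `≥ cθ^{2E(s+1)}∕(s+1)`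
((E36c) `witness_core_fading`; monotonicity of `FadingMemory` in the amplitude inline). [folklore] -/
theorem twoParam_witness_fading {c θ γ b : ℝ} (hc : 0 < c) (hθ0 : 0 < θ) (hθ1 : θ ≤ 1) (hγ : 0 < γ) (hb : 0 < b)
    (E s : ℕ) (hEb : c * θ ^ (2 * E) ≤ b) :
    ∃ (β : HBeta) (Λ : ℕ → ℕ → ℝ) (gA gB : ℕ → ℝ),
      RGEqH (2 * E + s * (2 * E + 1) + E * s * (s + 1) + 1) β gA ∧
      RGEqH (2 * E + s * (2 * E + 1) + E * s * (s + 1) + 1 + 1) β gB ∧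
      (∀ i, i ≤ 2 * E + s * (2 * E + 1) + E * s * (s + 1) + 1 → 0 < gA i ∧ gA i ≤ γ) ∧
      (∀ i, i ≤ 2 * E + s * (2 * E + 1) + E * s * (s + 1) + 1 + 1 → 0 < gB i ∧ gB i ≤ γ) ∧
      gA (2 * E + s * (2 * E + 1) + E * s * (s + 1) + 1) = gB (2 * E + s * (2 * E + 1) + E * s * (s + 1) + 1 + 1) ∧
      ScaleShiftRate c θ γ β ∧ HistLipschitz Λ γ β ∧ (∀ k i, i ≤ k → 0 ≤ Λ k i) ∧
      (∀ k, ∑ i ∈ range (k + 1), Λ k i ≤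
        (1 + 1 / γ ^ 2 + 5 * (b + c)) ^ 3 * (c / b + 1) * ((E : ℝ) + 1) ^ 3 * ((s : ℝ) + 1) ^ 7 * θ ^ (2 * E)) ∧
      FadingMemory ((1 + 1 / γ ^ 2 + (b + c) * ((2 * E + s * (2 * E + 1) + E * s * (s + 1) : ℕ) + 2 : ℝ)) ^ 3 * (c / b + s) /
        θ ^ (2 * E * s + 1)) θ Λ ∧
      BetaLowerH 0 γ β ∧ EventualLowerH b γ 0 β ∧
      c * θ ^ (2 * E * (s + 1)) / (s + 1) ≤ disc gA gB (2 * E + s * (2 * E + 1) + E * s * (s + 1)) := by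
  obtain ⟨a, ha⟩ : ∃ a : ℕ → ℕ, ∀ t, a t = 2 * E * (t + 1) + 1 := ⟨_, fun _ => rfl⟩
  obtain ⟨k, hk⟩ : ∃ k : ℕ → ℕ, ∀ t, k t = 2 * E + t * (2 * E + 1) + E * t * (t + 1) := ⟨_, fun _ => rfl⟩
  have ha0 : a 0 = k 0 + 1 := by rw [ha, hk]; ring
  have hak : ∀ t, t < s → k (t + 1) = k t + a (t + 1) := fun t _ => by rw [hk, hk, ha]; ring
  have hεb : ∀ t, t ≤ s → c * θ ^ (a t - 1) / (s + 1) ≤ b := by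
    intro t _
    have hst : 2 * E ≤ a t - 1 := by rw [ha, Nat.add_sub_cancel]; exact Nat.le_mul_of_pos_right _ (Nat.succ_pos t)
    have hle : c * θ ^ (a t - 1) ≤ c * θ ^ (2 * E) := mul_le_mul_of_nonneg_left (pow_le_pow_of_le_one hθ0.le hθ1 hst) hc.le
    have hd : c * θ ^ (a t - 1) / (s + 1) ≤ c * θ ^ (a t - 1) :=
      div_le_self (by positivity) (by linarith [(Nat.cast_nonneg s : (0 : ℝ) ≤ s)])
    linarith
  obtain ⟨β, Λ, gA, gB, hRA, hRB, hAbox, hBbox, hpin, hSSR, hHL, hΛ0, hrows, hfade, hsign, hfloor, hdisc⟩ :=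
    witness_core_fading hc hθ0 hθ1 hγ hb ha0 hak hεb
  have hks : k s = 2 * E + s * (2 * E + 1) + E * s * (s + 1) := hk s
  have has : a s - 1 = 2 * E * (s + 1) := by rw [ha, Nat.add_sub_cancel]
  rw [hks] at hRA hRB hAbox hBbox hpin hdisc
  rw [has] at hdisc
  refine ⟨β, Λ, gA, gB, hRA, hRB, hAbox, hBbox, hpin, hSSR, hHL, hΛ0,
    fun kk => (hrows kk).trans (twoParam_cost_le hc hθ0 hγ hb E s ha hk),
    fun kk i hik => ⟨(hfade kk i hik).1, (hfade kk i hik).2.trans (mul_le_mul_of_nonneg_right ?_ (pow_nonneg hθ0.le _))⟩,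
    hsign, hfloor, hdisc⟩
  -- the raw fading constant is at most C_{E,s}
  have hθle : ∀ n m : ℕ, n ≤ m → (θ ^ n)⁻¹ ≤ (θ ^ m)⁻¹ := fun n m hnm => by
    rw [inv_le_inv₀ (pow_pos hθ0 _) (pow_pos hθ0 _)]
    exact pow_le_pow_of_le_one hθ0.le hθ1 hnm
  have hP : (0 : ℝ) ≤ (1 + (1 / γ ^ 2 + (b + c) * (k s + 2))) ^ 3 := by positivity
  have hPe : (1 + (1 / γ ^ 2 + (b + c) * ((k s : ℝ) + 2))) ^ 3
      = (1 + 1 / γ ^ 2 + (b + c) * (((2 * E + s * (2 * E + 1) + E * s * (s + 1) : ℕ) : ℝ) + 2)) ^ 3 := by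
    rw [hks]; ring
  have h0 : c * θ ^ (a 0 - 1) / (s + 1) / b / θ ^ a 0 ≤ c / b / θ ^ (2 * E * s + 1) := by
    have ha0' : a 0 = 2 * E + 1 := by rw [ha]; ring
    rw [ha0', Nat.add_sub_cancel]
    have e : c * θ ^ (2 * E) / (s + 1) / b / θ ^ (2 * E + 1) = c / b / θ / ((s : ℝ) + 1) := by
      rw [pow_succ]; field_simp
    rw [e]
    have h1 : c / b / θ / ((s : ℝ) + 1) ≤ c / b / θ := div_le_self (by positivity) (by linarith [(Nat.cast_nonneg s : (0 : ℝ) ≤ s)])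
    refine h1.trans ?_
    rw [div_eq_mul_inv (c / b) θ, div_eq_mul_inv (c / b)]
    refine mul_le_mul_of_nonneg_left ?_ (by positivity)
    have := hθle 1 (2 * E * s + 1) (by omega)
    rwa [pow_one] at this
  have ht : ∀ t ∈ range s, θ ^ (a (t + 1) - 1) / θ ^ (a t - 1) / θ ^ a (t + 1) ≤ 1 / θ ^ (2 * E * s + 1) := by
    intro t htm
    have hts : t < s := mem_range.mp htm
    have e : θ ^ (a (t + 1) - 1) / θ ^ (a t - 1) / θ ^ a (t + 1) = (θ ^ a t)⁻¹ := by
      have h1 : a (t + 1) = (a (t + 1) - 1) + 1 := by rw [ha]; omega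
      have h2 : a t = (a t - 1) + 1 := by rw [ha]; omega
      rw [h2, h1, Nat.add_sub_cancel, Nat.add_sub_cancel, pow_succ, pow_succ]
      field_simp
    rw [e, one_div]
    refine hθle (a t) (2 * E * s + 1) ?_
    rw [ha]
    have : t + 1 ≤ s := hts
    nlinarith [Nat.zero_le E]
  calc (1 + (1 / γ ^ 2 + (b + c) * ((k s : ℝ) + 2))) ^ 3 *
        (c * θ ^ (a 0 - 1) / (s + 1) / b / θ ^ a 0 + ∑ t ∈ range s, θ ^ (a (t + 1) - 1) / θ ^ (a t - 1) / θ ^ a (t + 1))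
      ≤ (1 + (1 / γ ^ 2 + (b + c) * ((k s : ℝ) + 2))) ^ 3 *
        (c / b / θ ^ (2 * E * s + 1) + ∑ _t ∈ range s, 1 / θ ^ (2 * E * s + 1)) :=
        mul_le_mul_of_nonneg_left (add_le_add h0 (sum_le_sum ht)) hP
    _ = (1 + 1 / γ ^ 2 + (b + c) * (((2 * E + s * (2 * E + 1) + E * s * (s + 1) : ℕ) : ℝ) + 2)) ^ 3 * (c / b + s) /
        θ ^ (2 * E * s + 1) := by
        rw [sum_const, card_range, nsmul_eq_mul, hPe]
        field_simp

/-- **THE RATIO DEGRADES AT LEAST LIKE `log log C∕log C`.**  If a ratio `κ ≥ 0` and a constant `D` serve the class with fading constant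
`C_{E,s}` (above) and row budget `(1 + 1∕γ² + 5(b+c))³(c∕b+1)(E+1)³(s+1)⁷θ^{2E}` — `disc gA gB j ≤ D·κ^j` for every member of (E33g)'s class with
these binders, every cutoff and `j ≤ K` — then `cθ^{2E(s+1)}∕(s+1) ≤ D·κ^{2E + s(2E+1) + Es(s+1)}`.  Along `E ≍ log s∕log(1∕θ)` (a fixed row budget
`M` admits every `s`) this reads `log(1∕κ(C)) ≲ log(1∕θ)·log log C∕log C`; (E36b) guarantees `≳ log(1∕θ)·log(1∕(4MU))∕log(C∕M)`. [folklore] -/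
theorem ratio_lower_bound_twoParam {c θ γ b κ D : ℝ} (hc : 0 < c) (hθ0 : 0 < θ) (hθ1 : θ ≤ 1) (hγ : 0 < γ) (hb : 0 < b)
    (E s : ℕ) (hEb : c * θ ^ (2 * E) ≤ b)
    (hserve : ∀ (β : HBeta) (Λ : ℕ → ℕ → ℝ) (K : ℕ) (gA gB : ℕ → ℝ),
      RGEqH K β gA → RGEqH (K + 1) β gB →
      (∀ i, i ≤ K → 0 < gA i ∧ gA i ≤ γ) → (∀ i, i ≤ K + 1 → 0 < gB i ∧ gB i ≤ γ) → gA K = gB (K + 1) →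
      ScaleShiftRate c θ γ β → HistLipschitz Λ γ β →
      FadingMemory ((1 + 1 / γ ^ 2 + (b + c) * ((2 * E + s * (2 * E + 1) + E * s * (s + 1) : ℕ) + 2 : ℝ)) ^ 3 * (c / b + s) /
        θ ^ (2 * E * s + 1)) θ Λ →
      (∀ k, ∑ i ∈ range (k + 1), Λ k i ≤
        (1 + 1 / γ ^ 2 + 5 * (b + c)) ^ 3 * (c / b + 1) * ((E : ℝ) + 1) ^ 3 * ((s : ℝ) + 1) ^ 7 * θ ^ (2 * E)) →
      BetaLowerH 0 γ β → EventualLowerH b γ 0 β →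
      ∀ j, j ≤ K → disc gA gB j ≤ D * κ ^ j) :
    c * θ ^ (2 * E * (s + 1)) / (s + 1) ≤ D * κ ^ (2 * E + s * (2 * E + 1) + E * s * (s + 1)) := by
  obtain ⟨β, Λ, gA, gB, hRA, hRB, hAbox, hBbox, hpin, hSSR, hHL, _, hrows, hfade, hsign, hfloor, hdisc⟩ :=
    twoParam_witness_fading hc hθ0 hθ1 hγ hb E s hEb
  exact hdisc.trans (hserve β Λ _ gA gB hRA hRB hAbox hBbox hpin hSSR hHL hfade hrows hsign hfloor _ (Nat.le_succ _))

end Summit.QuantumFields.BalabanUV.Beta.EriceRemainderEnclosureHistoryFadingWitnessEnvelope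

end
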